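import Summits.CriticalPhenomena.PercolationContinuityZ3.Theorems.PercNearOneGluingNoHeavySamePHeisenbergCylinder
import Summits.CriticalPhenomena.PercolationContinuityZ3.Theorems.Transplant.HeisenbergCriticalProbLtOne
import HarnessLib

/-!
# The cylinders `{|x|, |y| ≤ ℓ}` (`ℓ ≥ 1`) of the Heisenberg Cayley graph are CONNECTED as induced subgraphs
# (interface obligation (κ) `cyl_connected` of the general-node design of record, `HOME/SHEAR-SCOPE.md` §p3 3.0 item 4 (C2) / §3.3; VERDICTS V83)

builds on p205010 (kernel theorem, internal audit signed; external expert review pending) — nothing in this file uses p205010.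
Lane `prim-bschramm`, seat `prim-bschramm-p3` (gen 4, class C2 = Heisenberg); helper file (`--supports stmt-CriticalPhenomena-4575 --as helper`).

`heisCylGraph ℓ = cayleyGraph.induce (heisCyl ℓ)`, `heisCyl ℓ = {(x,y,z) : |x| ≤ ℓ, |y| ≤ ℓ}` (p4, `…SamePHeisenbergCylinder`).  For `ℓ ≥ 1` it is
connected although NO edge of `Cay(H₃(ℤ); a, b)` is central: inside the cylinder the commutator 4-cycle `a b a⁻¹ b⁻¹` at the column `x = y = 0`
raises `z` by one (`(0,0,z) ∼ (1,0,z) ∼ (1,1,z+1) ∼ (0,1,z+1) ∼ (0,0,z+1)`, all four inside since `ℓ ≥ 1`), `b`-steps at `x = 0` keep `z`, and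
`a`-steps keep `z`; so `(0,0,0) ↝ (0,0,z) ↝ (0,y,z) ↝ (x,y,z)`.  (For `ℓ = 0` the cylinder is the centre with no edges — the statement is sharp.)
* `heisCyl_reach_z_succ`, `heisCyl_reach_z`, `heisCyl_reach_y(_nat)`, `heisCyl_reach_x(_nat)`, `heisCyl_reach_all`, **`heisCylGraph_connected`** (`1 ≤ ℓ`),
  `heisCylGraph_preconnected`;
(the degree bound (μ) for `H₃` is the tree's `SameP.heis_degree_le`; the generator edges are `heis_adj_mulA/B`.)
[cite: CheegerKleinerNaor2011, §1.1 (the model (x,y,z)·(x',y',z') = (x+x', y+y', z+z'+xy'))] [cite: MartineauSevero2019, Cor. 2.2 (hypothesis: connected subgraph)]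
-/

noncomputable section

namespace Summit.CriticalPhenomena.PercolationContinuityZ3.Theorems

namespace Transplant

open Literature.Geometry.MetricEmbeddings (heisMul cayleyGraph)
open SimpleGraph SameP

/-! ## §1 Reachability inside the cylinder (generator edges: `heis_adj_mulA/B` of `HeisenbergCriticalProbLtOne`; degree `≤ 4`:
`SameP.heis_degree_le`) -/



variable {ℓ : ℕ}

/-- Membership in the cylinder, unfolded. [folklore] -/
theorem mem_heisCyl_iff {g : ℤ × ℤ × ℤ} : g ∈ heisCyl ℓ ↔ |g.1| ≤ ℓ ∧ |g.2.1| ≤ ℓ := Iff.rfl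

/-- An edge of `Cay(H₃)` between two cylinder points is an edge of the cylinder graph, hence reachability. [folklore] -/
theorem heisCyl_reach_of_adj {u v : ℤ × ℤ × ℤ} (hu : u ∈ heisCyl ℓ) (hv : v ∈ heisCyl ℓ) (h : cayleyGraph.Adj u v) :
    (heisCylGraph ℓ).Reachable ⟨u, hu⟩ ⟨v, hv⟩ := by
  refine SimpleGraph.Adj.reachable ?_
  rw [SimpleGraph.comap_adj, Function.Embedding.coe_subtype]
  exact h

/-- Transport of a reachability target along an equality of points. [folklore] -/
theorem heisCyl_reach_of_eq {a : heisCyl ℓ} {v v' : ℤ × ℤ × ℤ} {hv : v ∈ heisCyl ℓ} (h : v = v')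
    (hr : (heisCylGraph ℓ).Reachable a ⟨v, hv⟩) : (heisCylGraph ℓ).Reachable a ⟨v', h ▸ hv⟩ := by
  subst h; exact hr

/-- The column `(0, 0, z)` lies in every cylinder. [folklore] -/
theorem col_mem_heisCyl (z : ℤ) : ((0 : ℤ), (0 : ℤ), z) ∈ heisCyl ℓ := by
  rw [mem_heisCyl_iff]; simp

/-- A point with coordinates in `[-ℓ, ℓ]` lies in the cylinder. [folklore] -/
theorem mk_mem_heisCyl {x y : ℤ} (z : ℤ) (hx : -(ℓ : ℤ) ≤ x ∧ x ≤ ℓ) (hy : -(ℓ : ℤ) ≤ y ∧ y ≤ ℓ) : (x, y, z) ∈ heisCyl ℓ :=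
  ⟨abs_le.2 hx, abs_le.2 hy⟩

/-- **The commutator 4-cycle**: inside the cylinder (`ℓ ≥ 1`), `(0,0,z) ↝ (0,0,z+1)`. [cite: CheegerKleinerNaor2011, §1.1 ([a,b] is central)] -/
theorem heisCyl_reach_z_succ (hℓ : 1 ≤ ℓ) (z : ℤ) :
    (heisCylGraph ℓ).Reachable ⟨(0, 0, z), col_mem_heisCyl z⟩ ⟨(0, 0, z + 1), col_mem_heisCyl (z + 1)⟩ := by
  have h1ℓ : (1 : ℤ) ≤ ℓ := by exact_mod_cast hℓ
  have m1 : ((1 : ℤ), (0 : ℤ), z) ∈ heisCyl ℓ := mk_mem_heisCyl z (by omega) (by omega)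
  have m2 : ((1 : ℤ), (1 : ℤ), z + 1) ∈ heisCyl ℓ := mk_mem_heisCyl (z + 1) (by omega) (by omega)
  have m3 : ((0 : ℤ), (1 : ℤ), z + 1) ∈ heisCyl ℓ := mk_mem_heisCyl (z + 1) (by omega) (by omega)
  -- (0,0,z) ∼ (1,0,z)
  have s1 : (heisCylGraph ℓ).Reachable ⟨(0, 0, z), col_mem_heisCyl z⟩ ⟨(1, 0, z), m1⟩ := by
    have h := heis_adj_mulA 0 0 z
    simp only [zero_add] at h
    exact heisCyl_reach_of_adj _ _ h
  -- (1,0,z) ∼ (1,1,z+1)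
  have s2 : (heisCylGraph ℓ).Reachable ⟨(1, 0, z), m1⟩ ⟨(1, 1, z + 1), m2⟩ := by
    have h := heis_adj_mulB 1 0 z
    simp only [zero_add] at h
    exact heisCyl_reach_of_adj _ _ h
  -- (0,1,z+1) ∼ (1,1,z+1), used backwards
  have s3 : (heisCylGraph ℓ).Reachable ⟨(1, 1, z + 1), m2⟩ ⟨(0, 1, z + 1), m3⟩ := by
    have h := heis_adj_mulA 0 1 (z + 1)
    simp only [zero_add] at h
    exact (heisCyl_reach_of_adj _ _ h).symm
  -- (0,0,z+1) ∼ (0,1,z+1), used backwards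
  have s4 : (heisCylGraph ℓ).Reachable ⟨(0, 1, z + 1), m3⟩ ⟨(0, 0, z + 1), col_mem_heisCyl (z + 1)⟩ := by
    have h := heis_adj_mulB 0 0 (z + 1)
    simp only [zero_add, add_zero] at h
    exact (heisCyl_reach_of_adj _ _ h).symm
  exact ((s1.trans s2).trans s3).trans s4

/-- Inside the cylinder (`ℓ ≥ 1`) the whole central column is reachable from the identity: `(0,0,0) ↝ (0,0,z)`. [folklore] -/
theorem heisCyl_reach_z (hℓ : 1 ≤ ℓ) (z : ℤ) :
    (heisCylGraph ℓ).Reachable ⟨(0, 0, 0), col_mem_heisCyl 0⟩ ⟨(0, 0, z), col_mem_heisCyl z⟩ := by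
  induction z using Int.induction_on with
  | zero => exact SimpleGraph.Reachable.refl _
  | succ n ih => exact ih.trans (heisCyl_reach_z_succ hℓ n)
  | pred n ih =>
    have h := heisCyl_reach_z_succ hℓ (-(n : ℤ) - 1)
    have e : ((0 : ℤ), (0 : ℤ), -(n : ℤ) - 1 + 1) = (0, 0, -(n : ℤ)) := by rw [sub_add_cancel]
    exact ih.trans (heisCyl_reach_of_eq e h).symm

/-- `b`-steps along the column `x = 0` keep `z`: `(0,0,z) ↝ (0,±n,z)` for `n ≤ ℓ`. [folklore] -/
theorem heisCyl_reach_y_nat (z : ℤ) (n : ℕ) (hn : (n : ℤ) ≤ ℓ) :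
    (heisCylGraph ℓ).Reachable ⟨(0, 0, z), col_mem_heisCyl z⟩ ⟨(0, (n : ℤ), z), mk_mem_heisCyl z (by omega) (by omega)⟩ ∧
      (heisCylGraph ℓ).Reachable ⟨(0, 0, z), col_mem_heisCyl z⟩ ⟨(0, -(n : ℤ), z), mk_mem_heisCyl z (by omega) (by omega)⟩ := by
  induction n with
  | zero =>
    constructor
    · exact heisCyl_reach_of_eq (by simp) (SimpleGraph.Reachable.refl _)
    · exact heisCyl_reach_of_eq (by simp) (SimpleGraph.Reachable.refl _)
  | succ n ih =>
    have hn' : (n : ℤ) ≤ ℓ := by push_cast at hn; omega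
    obtain ⟨ihp, ihm⟩ := ih hn'
    have hn1 : (n : ℤ) + 1 ≤ ℓ := by push_cast at hn; exact hn
    have mp : ((0 : ℤ), (n : ℤ) + 1, z) ∈ heisCyl ℓ := mk_mem_heisCyl z (by omega) (by omega)
    have mm : ((0 : ℤ), -(n : ℤ) - 1, z) ∈ heisCyl ℓ := mk_mem_heisCyl z (by omega) (by omega)
    constructor
    · -- (0,n,z) ∼ (0,n+1,z)
      have h := heis_adj_mulB 0 (n : ℤ) z
      simp only [add_zero] at h
      have step := heisCyl_reach_of_adj (ℓ := ℓ) (mk_mem_heisCyl z (by omega) (by omega)) mp h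
      have e : ((0 : ℤ), (n : ℤ) + 1, z) = (0, ((n + 1 : ℕ) : ℤ), z) := by rw [Nat.cast_succ]
      exact heisCyl_reach_of_eq e (ihp.trans step)
    · -- (0,-n-1,z) ∼ (0,-n,z), used backwards
      have h := heis_adj_mulB 0 (-(n : ℤ) - 1) z
      simp only [add_zero, sub_add_cancel] at h
      have step := (heisCyl_reach_of_adj (ℓ := ℓ) mm (mk_mem_heisCyl z (by omega) (by omega)) h).symm
      have e : ((0 : ℤ), -(n : ℤ) - 1, z) = (0, -((n + 1 : ℕ) : ℤ), z) := by
        refine Prod.ext rfl (Prod.ext ?_ rfl); push_cast; ring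
      exact heisCyl_reach_of_eq e (ihm.trans step)

/-- `b`-steps along the column `x = 0` keep `z`: `(0,0,z) ↝ (0,y,z)` for `|y| ≤ ℓ`. [folklore] -/
theorem heisCyl_reach_y (z : ℤ) {y : ℤ} (hy : |y| ≤ ℓ) :
    (heisCylGraph ℓ).Reachable ⟨(0, 0, z), col_mem_heisCyl z⟩ ⟨(0, y, z), mk_mem_heisCyl z (by omega) (abs_le.1 hy)⟩ := by
  rcases le_or_gt 0 y with h0 | h0
  · obtain ⟨n, rfl⟩ := Int.eq_ofNat_of_zero_le h0
    exact (heisCyl_reach_y_nat z n (abs_le.1 hy).2).1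
  · obtain ⟨n, hn⟩ := Int.exists_eq_neg_ofNat (le_of_lt h0)
    subst hn
    have hn' : (n : ℤ) ≤ ℓ := by have := (abs_le.1 hy).1; omega
    exact (heisCyl_reach_y_nat z n hn').2

/-- `a`-steps keep `z`: `(0,y,z) ↝ (±n,y,z)` for `n ≤ ℓ`, `|y| ≤ ℓ`. [folklore] -/
theorem heisCyl_reach_x_nat {y : ℤ} (hy : |y| ≤ ℓ) (z : ℤ) (n : ℕ) (hn : (n : ℤ) ≤ ℓ) :
    (heisCylGraph ℓ).Reachable ⟨(0, y, z), mk_mem_heisCyl z (by omega) (abs_le.1 hy)⟩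
        ⟨((n : ℤ), y, z), mk_mem_heisCyl z (by omega) (abs_le.1 hy)⟩ ∧
      (heisCylGraph ℓ).Reachable ⟨(0, y, z), mk_mem_heisCyl z (by omega) (abs_le.1 hy)⟩
        ⟨(-(n : ℤ), y, z), mk_mem_heisCyl z (by omega) (abs_le.1 hy)⟩ := by
  induction n with
  | zero =>
    constructor
    · exact heisCyl_reach_of_eq (by simp) (SimpleGraph.Reachable.refl _)
    · exact heisCyl_reach_of_eq (by simp) (SimpleGraph.Reachable.refl _)
  | succ n ih =>
    have hn' : (n : ℤ) ≤ ℓ := by push_cast at hn; omega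
    obtain ⟨ihp, ihm⟩ := ih hn'
    have hn1 : (n : ℤ) + 1 ≤ ℓ := by push_cast at hn; exact hn
    have mp : ((n : ℤ) + 1, y, z) ∈ heisCyl ℓ := mk_mem_heisCyl z (by omega) (abs_le.1 hy)
    have mm : (-(n : ℤ) - 1, y, z) ∈ heisCyl ℓ := mk_mem_heisCyl z (by omega) (abs_le.1 hy)
    constructor
    · have h := heis_adj_mulA (n : ℤ) y z
      have step := heisCyl_reach_of_adj (ℓ := ℓ) (mk_mem_heisCyl z (by omega) (abs_le.1 hy)) mp h
      have e : ((n : ℤ) + 1, y, z) = (((n + 1 : ℕ) : ℤ), y, z) := by rw [Nat.cast_succ]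
      exact heisCyl_reach_of_eq e (ihp.trans step)
    · have h := heis_adj_mulA (-(n : ℤ) - 1) y z
      simp only [sub_add_cancel] at h
      have step := (heisCyl_reach_of_adj (ℓ := ℓ) mm (mk_mem_heisCyl z (by omega) (abs_le.1 hy)) h).symm
      have e : (-(n : ℤ) - 1, y, z) = (-((n + 1 : ℕ) : ℤ), y, z) := by
        refine Prod.ext ?_ rfl; push_cast; ring
      exact heisCyl_reach_of_eq e (ihm.trans step)

/-- `a`-steps keep `z`: `(0,y,z) ↝ (x,y,z)` for `|x|, |y| ≤ ℓ`. [folklore] -/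
theorem heisCyl_reach_x {y : ℤ} (hy : |y| ≤ ℓ) (z : ℤ) {x : ℤ} (hx : |x| ≤ ℓ) :
    (heisCylGraph ℓ).Reachable ⟨(0, y, z), mk_mem_heisCyl z (by omega) (abs_le.1 hy)⟩
      ⟨(x, y, z), mk_mem_heisCyl z (abs_le.1 hx) (abs_le.1 hy)⟩ := by
  rcases le_or_gt 0 x with h0 | h0
  · obtain ⟨n, rfl⟩ := Int.eq_ofNat_of_zero_le h0
    exact (heisCyl_reach_x_nat hy z n (abs_le.1 hx).2).1
  · obtain ⟨n, hn⟩ := Int.exists_eq_neg_ofNat (le_of_lt h0)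
    subst hn
    have hn' : (n : ℤ) ≤ ℓ := by have := (abs_le.1 hx).1; omega
    exact (heisCyl_reach_x_nat hy z n hn').2

/-- Every cylinder point is reachable from the identity (`ℓ ≥ 1`). [folklore] -/
theorem heisCyl_reach_all (hℓ : 1 ≤ ℓ) (v : heisCyl ℓ) :
    (heisCylGraph ℓ).Reachable ⟨(0, 0, 0), col_mem_heisCyl 0⟩ v := by
  obtain ⟨⟨x, y, z⟩, hv⟩ := v
  have hx : |x| ≤ ℓ := hv.1
  have hy : |y| ≤ ℓ := hv.2
  exact ((heisCyl_reach_z hℓ z).trans (heisCyl_reach_y z hy)).trans (heisCyl_reach_x hy z hx)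

/-- **The cylinder graph `{|x|, |y| ≤ ℓ}` of `Cay(H₃(ℤ); a, b)` is connected for `ℓ ≥ 1`** (interface obligation (κ) for `H₃`).
[cite: MartineauSevero2019, Cor. 2.2 (hypothesis: connected subgraph)] -/
theorem heisCylGraph_connected (hℓ : 1 ≤ ℓ) : (heisCylGraph ℓ).Connected := by
  haveI : Nonempty (heisCyl ℓ) := ⟨⟨(0, 0, 0), col_mem_heisCyl 0⟩⟩
  exact ⟨fun u v => ((heisCyl_reach_all hℓ u).symm).trans (heisCyl_reach_all hℓ v)⟩

/-- The same as preconnectedness. [folklore] -/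
theorem heisCylGraph_preconnected (hℓ : 1 ≤ ℓ) : (heisCylGraph ℓ).Preconnected :=
  (heisCylGraph_connected hℓ).preconnected

end Transplant

end Summit.CriticalPhenomena.PercolationContinuityZ3.Theorems

end
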